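import Summits.AtomisticToContinuum.FouriersLaw.Theorems.HiddenChargeMazurOpenMazurBridgeThomson
import Summits.AtomisticToContinuum.FouriersLaw.Theorems.JunctionLocalitySuperadditiveResistanceKuboLimit

/-!
# `HiddenChargeMazur.StaticKubo`, line `birth`, stub `stub_kuboPairing` — the Green–Kubo pairing of any Poisson solution

Helper file (`--supports stmt-AtomisticToContinuum-13510`, crux decl `HiddenChargeMazur.StaticKubo`, registered
stub `stub_kuboPairing` of the skeleton `Cruxes/StaticKubo/Lines/birth.lean`, rev 3; route `HiddenChargeMazur`,
sub-problem `FouriersLaw`, summit `AtomisticToContinuum`).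

For the pinned anharmonic chain `P = pinnedChain ω₂ lam β γ` (all parameters `> 0`), `T > 0`, `N ≥ 2`, the
unnormalised Gibbs density `ρ = e^{-H/T}`, the Gibbs state `μ_T = volume.tilted (-H/T)`, the equilibrium
generator `L = L_{T,T}` and the total current `J = Σ_i j_i`:

* `integral_mul_source_eq_of_poisson_pair` — **two classical solutions of the same Poisson equation have the
  same pairing with the source**: if `f, h ∈ C² ∩ L²(μ_T)` both solve `L f = -k`, `L h = -k` pointwise
  (`k` continuous, in `L²(μ_T)`), then `∫ f k ρ = ∫ h k ρ`.  Proof: the tap energy identities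
  `∫ f k ρ = γT Σ_b ‖∂_{p_b} f‖²`, `∫ h k ρ = γT Σ_b ‖∂_{p_b} h‖²` (`Corrector.integral_mul_source_eq_dirichlet`)
  and the polarised Green identity `∫ (h k + f k) ρ = 2γT Σ_b ⟨∂_{p_b} f, ∂_{p_b} h⟩` (`Kubo.polar`) give
  `X + Y = 2Z` for `X = ∫ f k ρ`, `Y = ∫ h k ρ` and the bath cross form `Z`; Cauchy–Schwarz (through the
  discriminant of `t ↦ Σ_b ‖t ∂_b f - ∂_b h‖²`) gives `Z² ≤ XY`, whence `(X - Y)² ≤ 0`.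
* `stub_kuboPairing` — **the registered stub**: under weak-NESS uniqueness, along any steady-state family with
  response limit `D` at `(N, T)`, EVERY `F ∈ C²` with a value bound `|F| ≤ C e^{θH}` (`θ < 1/(2T)`) solving
  `L F = -J` has `D · ((N-1) T²) = ∫ F J dμ_T`.  Proof: the smooth Kubo corrector `u` of the tree
  (`Corrector.corrector_smooth`, `corrector_exists`), the PROVED open-chain Green–Kubo identity
  `(N-1)T²D = ∫₀^∞ ⟨J, P_tJ⟩_{μ_T}` (`openChainGreenKubo_holds`, `Corrector.greenKubo_of_openChainGreenKubo`),
  the corrector pairing `⟨u, J⟩ = Z ∫₀^∞⟨J, P_tJ⟩` (`pinnedChain_integral_corrector_mul_withDensity`), and the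
  first bullet with `f = F`, `h = u`, `k = J`.

References: Kundu–Dhar–Narayan 2009 (the open-chain Green–Kubo formula); Cuneo–Eckmann–Hairer–Rey-Bellet 2018,
Thm 2.13; Bonetto–Lebowitz–Rey-Bellet 2000, §5.2.  No definitions; nothing here closes an item by itself.
-/

noncomputable section

open MeasureTheory Filter Topology ProbabilityTheory
open scoped ContDiff NNReal ENNReal
open Literature.MathematicalPhysics.KineticTheory.HeatConduction
open Summit.AtomisticToContinuum.FouriersLaw.Theorems.SuperadditiveResistance.DeviceLiouville
open Summit.AtomisticToContinuum.FouriersLaw.Theorems.SuperadditiveResistance.Kubo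
open Summit.AtomisticToContinuum.FouriersLaw.Theorems.OddSectorIrreversibility.Corrector

namespace Summit.AtomisticToContinuum.FouriersLaw.Theorems.HiddenChargeMazur

variable {N : ℕ}

section Pairing

variable {ω₂ lam β γ : ℝ} (hω : 0 < ω₂) (hl : 0 ≤ lam) (hβ : 0 ≤ β) (hγ : 0 < γ) {T : ℝ} (hT : 0 < T)
include hω hl hβ hγ hT

/-- **Two classical solutions of the same Poisson equation have the same pairing with the source.**
For the pinned chain at temperature `T > 0` (`N ≥ 1`): if `f, h ∈ C² ∩ L²(μ_T)` solve
`L_{T,T} f = -k` and `L_{T,T} h = -k` pointwise, with `k` continuous and in `L²(μ_T)`, then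
`∫ f k e^{-H/T} = ∫ h k e^{-H/T}` (tap energy identities + polarised Green identity + Cauchy–Schwarz).
[Kundu–Dhar–Narayan 2009, p. 3] [folklore] -/
theorem integral_mul_source_eq_of_poisson_pair (hN : 0 < N) {f h k : PhaseSpace N → ℝ}
    (hf : ContDiff ℝ 2 f) (hh : ContDiff ℝ 2 h)
    (hf2 : MemLp f 2 ((pinnedChain ω₂ lam β γ).gibbsMeasure N T))
    (hh2 : MemLp h 2 ((pinnedChain ω₂ lam β γ).gibbsMeasure N T))
    (hkc : Continuous k) (hk2 : MemLp k 2 ((pinnedChain ω₂ lam β γ).gibbsMeasure N T))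
    (hpf : ∀ x, (pinnedChain ω₂ lam β γ).generator N T T f x = -k x)
    (hph : ∀ x, (pinnedChain ω₂ lam β γ).generator N T T h x = -k x) :
    ∫ x, f x * k x * (pinnedChain ω₂ lam β γ).gibbsDensity N T x =
      ∫ x, h x * k x * (pinnedChain ω₂ lam β γ).gibbsDensity N T x := by
  set P := pinnedChain ω₂ lam β γ with hP
  set π := P.gibbsMeasure N T with hπ
  set ρ := P.gibbsDensity N T with hρ
  set B := OscillatorChain.bathWeight N with hB
  -- bath sites
  set b₀ : Fin N := ⟨0, hN⟩ with hb₀def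
  set b₁ : Fin N := ⟨N - 1, by omega⟩ with hb₁def
  have hb₀ : b₀.val = 0 := rfl
  have hb₁ : b₁.val = N - 1 := rfl
  have hB₀ : 0 < OscillatorChain.bathWeight N b₀ := by
    unfold OscillatorChain.bathWeight; rw [if_pos hb₀]; split_ifs <;> norm_num
  have hB₁ : 0 < OscillatorChain.bathWeight N b₁ := by
    unfold OscillatorChain.bathWeight; rw [if_pos hb₁]; split_ifs <;> norm_num
  -- the equations in Liouville/bath form
  have hpf' : ∀ x, 1 * liouvilleOp P N f x + γ * bathOp N B T f x = -k x := fun x => by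
    rw [one_mul, ← hpf x, generator_eq_liouvilleOp_add]; rfl
  have hph' : ∀ x, 1 * liouvilleOp P N h x + γ * bathOp N B T h x = -k x := fun x => by
    rw [one_mul, ← hph x, generator_eq_liouvilleOp_add]; rfl
  -- the diagonal (tap energy) identities and the polarised identity
  have hX := integral_mul_source_eq_dirichlet hω hl hβ hγ hT hf hf2 hkc hk2 hpf
  have hY := integral_mul_source_eq_dirichlet hω hl hβ hγ hT hh hh2 hkc hk2 hph
  have hZ := polar hω hl hβ N hT B
    (Literature.MathematicalPhysics.KineticTheory.HeatConduction.bathWeight_nonneg N) 1 hγ hf hh hf2 hh2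
    hk2 hk2 hpf' hph'
  rw [sum_bathWeight_mul _ hb₀ hb₁] at hX hY hZ
  -- square integrability of the bath momentum derivatives
  have hdf2 : ∀ {i : Fin N}, 0 < OscillatorChain.bathWeight N i → MemLp (partialP i f) 2 π := fun hi =>
    memLp_partialP_of_poisson hω hl hβ hγ hT hf hf2 hk2 hpf hi
  have hdh2 : ∀ {i : Fin N}, 0 < OscillatorChain.bathWeight N i → MemLp (partialP i h) 2 π := fun hi =>
    memLp_partialP_of_poisson hω hl hβ hγ hT hh hh2 hk2 hph hi
  -- named integrals
  set a₀ := ∫ x, partialP b₀ f x ^ 2 * ρ x with ha₀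
  set a₁ := ∫ x, partialP b₁ f x ^ 2 * ρ x with ha₁
  set e₀ := ∫ x, partialP b₀ h x ^ 2 * ρ x with he₀
  set e₁ := ∫ x, partialP b₁ h x ^ 2 * ρ x with he₁
  set c₀ := ∫ x, partialP b₀ f x * partialP b₀ h x * ρ x with hc₀
  set c₁ := ∫ x, partialP b₁ f x * partialP b₁ h x * ρ x with hc₁
  have iff0 : Integrable fun x => partialP b₀ f x ^ 2 * ρ x :=
    integrable_sq_mul_gibbsDensity hω hl hβ γ N hT (hdf2 hB₀)
  have iff1 : Integrable fun x => partialP b₁ f x ^ 2 * ρ x :=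
    integrable_sq_mul_gibbsDensity hω hl hβ γ N hT (hdf2 hB₁)
  have ihh0 : Integrable fun x => partialP b₀ h x ^ 2 * ρ x :=
    integrable_sq_mul_gibbsDensity hω hl hβ γ N hT (hdh2 hB₀)
  have ihh1 : Integrable fun x => partialP b₁ h x ^ 2 * ρ x :=
    integrable_sq_mul_gibbsDensity hω hl hβ γ N hT (hdh2 hB₁)
  have ifh0 : Integrable fun x => partialP b₀ f x * partialP b₀ h x * ρ x :=
    integrable_mul_mul_gibbsDensity hω hl hβ γ N hT (hdf2 hB₀) (hdh2 hB₀)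
  have ifh1 : Integrable fun x => partialP b₁ f x * partialP b₁ h x * ρ x :=
    integrable_mul_mul_gibbsDensity hω hl hβ γ N hT (hdf2 hB₁) (hdh2 hB₁)
  -- `∫ (h k + f k) ρ = ∫ h k ρ + ∫ f k ρ`
  have ihk : Integrable fun x => h x * k x * ρ x := integrable_mul_mul_gibbsDensity hω hl hβ γ N hT hh2 hk2
  have ifk : Integrable fun x => f x * k x * ρ x := integrable_mul_mul_gibbsDensity hω hl hβ γ N hT hf2 hk2
  have hsum : ∫ x, (h x * k x + f x * k x) * ρ x = (∫ x, h x * k x * ρ x) + ∫ x, f x * k x * ρ x := by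
    rw [← integral_add ihk ifk]
    exact integral_congr_ae (ae_of_all _ fun x => by ring)
  rw [hsum] at hZ
  -- Cauchy–Schwarz through the discriminant: `(c₀ + c₁)² ≤ (a₀ + a₁)(e₀ + e₁)`
  clear_value a₀ a₁ e₀ e₁ c₀ c₁
  have hquad : ∀ t : ℝ, 0 ≤ (a₀ + a₁) * (t * t) + (-(2 * (c₀ + c₁))) * t + (e₀ + e₁) := by
    intro t
    have hnn : 0 ≤ ∫ x, ((t * partialP b₀ f x - partialP b₀ h x) ^ 2 +
        (t * partialP b₁ f x - partialP b₁ h x) ^ 2) * ρ x :=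
      integral_nonneg fun x => mul_nonneg (add_nonneg (sq_nonneg _) (sq_nonneg _)) (P.gibbsDensity_pos N T x).le
    have e : (fun x => ((t * partialP b₀ f x - partialP b₀ h x) ^ 2 +
        (t * partialP b₁ f x - partialP b₁ h x) ^ 2) * ρ x) = fun x =>
        (t ^ 2 * (partialP b₀ f x ^ 2 * ρ x) + t ^ 2 * (partialP b₁ f x ^ 2 * ρ x)) -
          (2 * t * (partialP b₀ f x * partialP b₀ h x * ρ x) +
            2 * t * (partialP b₁ f x * partialP b₁ h x * ρ x)) +
          (partialP b₀ h x ^ 2 * ρ x + partialP b₁ h x ^ 2 * ρ x) := by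
      funext x; ring
    have j1 : Integrable fun x => t ^ 2 * (partialP b₀ f x ^ 2 * ρ x) + t ^ 2 * (partialP b₁ f x ^ 2 * ρ x) :=
      (iff0.const_mul _).add (iff1.const_mul _)
    have j2 : Integrable fun x => 2 * t * (partialP b₀ f x * partialP b₀ h x * ρ x) +
        2 * t * (partialP b₁ f x * partialP b₁ h x * ρ x) :=
      (ifh0.const_mul _).add (ifh1.const_mul _)
    have j3 : Integrable fun x => partialP b₀ h x ^ 2 * ρ x + partialP b₁ h x ^ 2 * ρ x := ihh0.add ihh1
    have j12 : Integrable fun x => (t ^ 2 * (partialP b₀ f x ^ 2 * ρ x) + t ^ 2 * (partialP b₁ f x ^ 2 * ρ x)) -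
        (2 * t * (partialP b₀ f x * partialP b₀ h x * ρ x) +
          2 * t * (partialP b₁ f x * partialP b₁ h x * ρ x)) := j1.sub j2
    have i1' : Integrable fun x => t ^ 2 * (partialP b₀ f x ^ 2 * ρ x) := iff0.const_mul _
    have i2' : Integrable fun x => t ^ 2 * (partialP b₁ f x ^ 2 * ρ x) := iff1.const_mul _
    have i3' : Integrable fun x => 2 * t * (partialP b₀ f x * partialP b₀ h x * ρ x) := ifh0.const_mul _
    have i4' : Integrable fun x => 2 * t * (partialP b₁ f x * partialP b₁ h x * ρ x) := ifh1.const_mul _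
    rw [e, integral_add j12 j3, integral_sub j1 j2, integral_add i1' i2', integral_add i3' i4',
      integral_add ihh0 ihh1, integral_const_mul, integral_const_mul, integral_const_mul,
      integral_const_mul] at hnn
    rw [← ha₀, ← ha₁, ← he₀, ← he₁, ← hc₀, ← hc₁] at hnn
    have e2 : (a₀ + a₁) * (t * t) + (-(2 * (c₀ + c₁))) * t + (e₀ + e₁) =
        t ^ 2 * a₀ + t ^ 2 * a₁ - (2 * t * c₀ + 2 * t * c₁) + (e₀ + e₁) := by ring
    rw [e2]; exact hnn
  have hdisc := discrim_le_zero hquad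
  rw [discrim] at hdisc
  have hsq : (-(2 * (c₀ + c₁))) ^ 2 = 4 * (c₀ + c₁) ^ 2 := by ring
  rw [hsq] at hdisc
  have hCS : (c₀ + c₁) ^ 2 ≤ (a₀ + a₁) * (e₀ + e₁) := by linarith
  -- `X = γT(a₀+a₁)`, `Y = γT(e₀+e₁)`, `X + Y = 2γT(c₀+c₁)`, hence `(X - Y)² ≤ 0`
  set X := ∫ x, f x * k x * ρ x with hXdef
  set Y := ∫ x, h x * k x * ρ x with hYdef
  clear_value X Y
  have hγT : 0 < γ * T := mul_pos hγ hT
  have h1 : (c₀ + c₁) ^ 2 * (2 * γ * T) ^ 2 = (X + Y) ^ 2 := by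
    have hXY : X + Y = 2 * γ * T * (c₀ + c₁) := by linarith [hZ]
    rw [hXY]; ring
  have h2 : (a₀ + a₁) * (e₀ + e₁) * (2 * γ * T) ^ 2 = 4 * (X * Y) := by
    rw [hX, hY]; ring
  have h3 : (X + Y) ^ 2 ≤ 4 * (X * Y) := by
    rw [← h1, ← h2]
    exact mul_le_mul_of_nonneg_right hCS (sq_nonneg _)
  have h4 : (X - Y) ^ 2 ≤ 0 := by nlinarith [h3]
  have h5 : (X - Y) ^ 2 = 0 := le_antisymm h4 (sq_nonneg _)
  have h6 : X - Y = 0 := pow_eq_zero_iff two_ne_zero |>.1 h5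
  linarith

end Pairing

end Summit.AtomisticToContinuum.FouriersLaw.Theorems.HiddenChargeMazur

/-! ### The registered stub -/

namespace Summit.AtomisticToContinuum.FouriersLaw.Cruxes.StaticKubo.Birth.Stubs

open Summit.AtomisticToContinuum.FouriersLaw.Theorems
open Summit.AtomisticToContinuum.FouriersLaw.Theorems.HiddenChargeMazur

/-- **stub 2 — `stub_kuboPairing` (the Green–Kubo pairing of ANY value-class Poisson solution), proved.**
For `pinnedChain ω₂ lam β γ` (all `> 0`), under weak-NESS uniqueness, along any steady-state family `μ`,
for `T > 0`, `N ≥ 2` and any response limit `D` of `δ ↦ totalCurrent(μ N (T+δ/2) (T−δ/2))/δ` at `0`: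
EVERY `F ∈ C²` with a value bound `|F| ≤ C e^{θH}` (`θ < 1/(2T)`) solving `generator N T T F = −J`
satisfies `D · ((N−1) T²) = ∫ F · J dGibbs_{N,T}`.  Proof: open-chain Green–Kubo identity (tree) for the
smooth Kubo corrector `u`, transferred to `F` by `integral_mul_source_eq_of_poisson_pair`.
[Kundu–Dhar–Narayan 2009, p. 3; Cuneo–Eckmann–Hairer–Rey-Bellet 2018, Thm 2.13] -/
theorem stub_kuboPairing :
    ∀ ω₂ lam β γ : ℝ, 0 < ω₂ → 0 < lam → 0 < β → 0 < γ → ∀ P : Literature.MathematicalPhysics.KineticTheory.HeatConduction.OscillatorChain, P = Literature.MathematicalPhysics.KineticTheory.HeatConduction.pinnedChain ω₂ lam β γ → (∀ (N : ℕ) (T_L T_R : ℝ), 0 < T_L → 0 < T_R → ∀ μ ν : MeasureTheory.Measure (Literature.MathematicalPhysics.KineticTheory.HeatConduction.PhaseSpace N), P.IsSteadyState N T_L T_R μ → P.IsSteadyState N T_L T_R ν → μ = ν) → ∀ μ : (N : ℕ) → ℝ → ℝ → MeasureTheory.Measure (Literature.MathematicalPhysics.KineticTheory.HeatConduction.PhaseSpace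 N), (∀ (N : ℕ) (T_L T_R : ℝ), 0 < T_L → 0 < T_R → P.IsSteadyState N T_L T_R (μ N T_L T_R)) → ∀ T : ℝ, 0 < T → ∀ N : ℕ, 2 ≤ N → ∀ D : ℝ, Filter.Tendsto (fun δ : ℝ => P.totalCurrent (μ N (T + δ / 2) (T - δ / 2)) / δ) (nhdsWithin 0 {(0 : ℝ)}ᶜ) (nhds D) → ∀ F : Literature.MathematicalPhysics.KineticTheory.HeatConduction.PhaseSpace N → ℝ, ContDiff ℝ 2 F → (∃ C θ : ℝ, θ < 1 / (2 * T) ∧ ∀ z : Literature.MathematicalPhysics.KineticTheory.HeatConduction.PhaseSpace N, |F z| ≤ C * Real.exp (θ * P.hamiltonian N z)) → (∀ z : Literature.MathematicalPhysics.KineticTheory.HeatConduction.PhaseSpace N, P.generator N T T F z = -(∑ i : Fin N, P.bondCurrent N i z)) → D * (((N : ℝ) - 1) * T ^ 2) = ∫ z, F z * (∑ i : Fin N, P.bondCurrent N i z) ∂(MeasureTheory.volume.tilted fun x => -P.hamiltonian N x / T) := by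
  intro ω₂ lam β γ hω hl hβ hγ P hP huniq μf hμf T hT N hN D hD F hF hFgrowth hFL
  subst hP
  obtain ⟨CF, θF, hθF, hFb⟩ := hFgrowth
  have hN0 : 0 < N := by omega
  set P := pinnedChain ω₂ lam β γ with hP
  set π := P.gibbsMeasure N T with hπ
  set ρ := P.gibbsDensity N T with hρ
  set J : PhaseSpace N → ℝ := fun z => ∑ i : Fin N, P.bondCurrent N i z with hJ
  set μT : Measure (PhaseSpace N) := (volume : Measure (PhaseSpace N)).withDensity
    (fun x => ENNReal.ofReal (Real.exp (-(P.hamiltonian N x) / T))) with hμT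
  -- exponents
  have hϑ : 0 < 1 / (4 * T) := by positivity
  have h1ϑ : 1 / (4 * T) < 1 / T := by
    rw [div_lt_div_iff₀ (by positivity) hT]; nlinarith
  have h2ϑ : 2 * (1 / (4 * T)) < 1 / T := by
    rw [show 2 * (1 / (4 * T)) = 1 / (2 * T) by field_simp; ring, div_lt_div_iff₀ (by positivity) hT]
    nlinarith
  have h2θ : 2 * θF < 1 / T := by
    have h := hθF
    rw [lt_div_iff₀ (by positivity)] at h
    rw [lt_div_iff₀ hT]; linarith
  -- standard facts
  have hU : Continuous P.U := (pinnedChain_contDiff_U ω₂ lam β γ (n := 0)).continuous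
  have hV : Continuous P.V := (pinnedChain_contDiff_V ω₂ lam β γ (n := 0)).continuous
  have hJc : Continuous J := continuous_totalBondCurrent ω₂ lam β γ N
  obtain ⟨M, -, hJM⟩ := abs_totalBondCurrent_le_exp hω.le hl.le hβ.le γ N hϑ
  have hJ2 : MemLp J 2 π := memLp_two_of_abs_le_exp hω hl.le hβ.le hT γ hJc h2ϑ hJM
  -- the test function `F`
  have hFC : Continuous F := hF.continuous
  have hF2g : MemLp F 2 π := memLp_two_of_abs_le_exp hω hl.le hβ.le hT γ hFC h2θ hFb
  -- the corrector
  obtain ⟨u, hus, hae, hpde, hgrowthU⟩ := corrector_smooth hω hl hβ hγ hT hN0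
  have hu2 : ContDiff ℝ 2 u := hus.of_le (by norm_cast)
  have huC : Continuous u := hus.continuous
  obtain ⟨K₁, -, huK⟩ := hgrowthU (1 / (4 * T)) hϑ h1ϑ
  have hu2g : MemLp u 2 π := memLp_two_of_abs_le_exp hω hl.le hβ.le hT γ huC h2ϑ huK
  obtain ⟨K, c, -, -, -, -, -, -, -, hw2, hL2, -⟩ := corrector_exists hω hl hβ hγ hT hN0 hϑ h2ϑ
    (fun s z => ∫ y, J y ∂(P.transitionKernel N T T s.toNNReal z)) rfl
    (fun z => ∫ s in Set.Ioi (0 : ℝ), ∫ y, J y ∂(P.transitionKernel N T T s.toNNReal z)) rfl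
  have haeμ : (fun x => ∫ t in Set.Ioi (0 : ℝ), ∫ y, J y ∂(P.transitionKernel N T T t.toNNReal x)) =ᵐ[μT] u :=
    (withDensity_absolutelyContinuous _ _).ae_eq hae
  -- the Kundu–Dhar–Narayan identity `(N-1) T² D = ∫₀^∞ ⟨J, P_t J⟩` and `⟨u⋆, J⟩_{μT} = Z · ∫₀^∞ ⟨J, P_t J⟩`
  obtain ⟨hcorr, hKDN⟩ := greenKubo_of_openChainGreenKubo openChainGreenKubo_holds ω₂ lam β γ hω hl hβ hγ
    huniq μf hμf T hT N D hD
  obtain ⟨-, hwJ⟩ := pinnedChain_integral_corrector_mul_withDensity hω hl.le hβ hγ hN0 hT hw2 hL2 hcorr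
  set GK := ∫ t in Set.Ioi (0 : ℝ), ∫ z, J z * (∫ y, J y ∂(P.transitionKernel N T T t.toNNReal z)) ∂π
    with hGK
  set Zr := ∫ x, ρ x with hZr
  have hint : Integrable (P.gibbsDensity N T) := pinnedChain_integrable_gibbsDensity hω hl.le hβ.le γ N hT
  have hZpos : 0 < Zr := integral_exp_pos hint
  have hZ0 : Zr ≠ 0 := hZpos.ne'
  -- `⟨u, J⟩_ρ = Z · GK`
  have huJμ : ∫ x, u x * J x ∂μT = (∫ x : PhaseSpace N, Real.exp (-(P.hamiltonian N x) / T)) * GK := by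
    rw [← hwJ]
    refine integral_congr_ae ?_
    filter_upwards [haeμ] with x hx
    rw [← hx]
  have hZexp : Zr = ∫ x : PhaseSpace N, Real.exp (-(P.hamiltonian N x) / T) := rfl
  have huJρ : ∫ x, u x * J x * ρ x = Zr * GK := by
    have h1 : ∫ x, u x * J x ∂μT = ∫ x, u x * J x * ρ x :=
      integral_withDensity_gibbs P hU hV N T (fun x => u x * J x)
    rw [← h1, huJμ, hZexp]
  -- transfer from `u` to `F`
  have hFJρ : ∫ x, F x * J x * ρ x = ∫ x, u x * J x * ρ x :=
    integral_mul_source_eq_of_poisson_pair hω hl.le hβ.le hγ hT hN0 hF hu2 hF2g hu2g hJc hJ2 hFL hpde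
  -- normalise
  have hIπ : ∫ z, F z * J z ∂π = Zr⁻¹ * ∫ x, F x * J x * ρ x := P.integral_gibbsMeasure (fun z => F z * J z)
  change D * (((N : ℝ) - 1) * T ^ 2) = ∫ z, F z * J z ∂π
  rw [hIπ, hFJρ, huJρ, inv_mul_cancel_left₀ hZ0, ← hKDN]
  ring

end Summit.AtomisticToContinuum.FouriersLaw.Cruxes.StaticKubo.Birth.Stubs

end
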